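import Literature.NumberTheory.GaloisRepresentations.PresentationLayerTransport
import Literature.NumberTheory.GaloisRepresentations.HomDualIdeleReadout
import Literature.NumberTheory.GaloisRepresentations.IdeleLocalInvariantReadout
import Literature.NumberTheory.GaloisRepresentations.IdeleBarHomOfLocalHoms
import Literature.NumberTheory.GaloisRepresentations.HomDualCupConnecting
import HarnessLib

/-!
# The finite-place dictionary of the presentation road: the idèle local invariant of the layer class
# `iso^J_E((f^{U_E})_* [b])` IS `inv_{K_v}` of the readout class `(π_v ∘ f)_* res_v inf_E [b]`
# (Milne ADT I Lemma 4.13 / Thm. 4.10 (proof, p. 58); Tate, C–F VII §11.2 (bis))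

Topic `NumberTheory/GaloisRepresentations`; namespace `Literature.NumberTheory.GaloisRepresentations.HomDual`.
Theorems only (no definition, no named fact, no instance, no notation, no `sorry`).  Cell `bsd-schneider-ideate`,
seat door-c6 gen 18, Route A of crux `AnticycControlAdditiveK` (item 19295): step (d) of the E-side of hE's reciprocity
sum (memos/FINDING-door-c6-g17.md §2), joining

* door-c4 g17's idèle-layer value `classBarInv K (Inf_E c ∘ ∂(f ≫ g)) = inv_{E/K}(ε β)`,
  `β = iso^J_E ((f^{U_E})_* (δ_{S^{U_E}} c)) ∈ H²(Gal(E/K), J_E)` (`classBarInv_inflG_comp_boundary_presentation_idele`),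
* door-c5 g17's F7-dict (ii) `localInv E v [b] = inv_{K_v} [pull_{(s ↦ s|_E, π_v^E)} b]` (`IdeleCohomology.localInv_eq_readout`),
* door-c6 g17's K-side local term `inv_{K_v} ((π_v ∘ f)_* res_v (δ₁^K x))` of `poitouTate_selmerStructure_duality_of_globalTerms_of_imp`,
* (N2) in door-c4's currency (`LayerDelta.δ₁_infOneLayer_toAbsLayerOf`, file `PresentationLayerTransport`),

for an idèle projection `π_v : J̄ → K̄_vˣ` (`HomDual.IdeleProjection`) that is LAYER-COMPATIBLE at `v`:
`π_v [x]_E = idelePlaceReadout v (layerEmb E) x` for `x ∈ J_E` (the defining property of door-c5's projection).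

* `galoisCohomology.res_twoCocycleClass` — restriction to `K_v` on explicit continuous `2`-cocycles;
* `quotEquiv_symm_readoutPair_f`, `readoutPair_φ_layerEquiv`, `exists_readout_infTwo_toAbsLayer_eq`, `pull_readoutPair_apply`,
  **`twoCocycleClass_readout_infTwo_eq_pull`** — for EVERY `2`-cocycle `b` of `Γ_K ⧸ U_E` in `N₁^{U_E}` and the canonical
  representative `b'` of `iso^J_E ((f^{U_E})_* [b])`: `(π_v ∘ f)_* res_v (inf_E (toAbsLayer [b])) = [pull_{readoutPair v (layerEmb E)} b']`
  in `H²(K_v, K̄_vˣ)` (both are the class of `(s, t) ↦ π_v (f (b([res s], [res t])))`; the computation is split over several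
  declarations to stay within the default heartbeat budget);
* **`brauerInvariantEquiv_readout_infTwo_eq_localInv`** — hence `inv_{K_v}((π_v ∘ f)_* res_v (inf_E (toAbsLayer w))) =
  localInv E v (iso^J_E ((f^{U_E})_* w))` for every `w ∈ H²(Γ_K ⧸ U_E, N₁^{U_E})`;
* **`brauerInvariantEquiv_readout_δ₁_infOneLayer_eq_localInv`** — with `w = δ_{S^{U_E}} c` and
  `x = infOneLayer (toAbsLayerOf c)`: the K-side finite local term at `v` of the reciprocity sum (without its sign) IS the
  idèle local invariant at `v` of door-c4's class `β`.

HONEST FRAMING: cochain bookkeeping over the tree's dictionaries; no case of BSD or of Poitou–Tate is proved here.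

## References
* J. S. Milne, *Arithmetic Duality Theorems* (2nd ed. 2006), I Lemma 4.13, Thm. 4.10 (proof, p. 58). [MilneADT2006]
* J. W. S. Cassels, A. Fröhlich (eds.), *Algebraic Number Theory* (1967), Ch. VII (Tate) §7.3 Cor. 7.4 (b), §11.2 (bis).
  [CasselsFrohlichANT1967]
* J.-P. Serre, *Galois Cohomology* (1997), I §2.2 Prop. 8, §2.4. [SerreGaloisCohomology1997]
-/

noncomputable section

open CategoryTheory groupCohomology Field NumberField IsDedekindDomain
open Literature.Algebra.Homology Literature.Algebra.Homology.DiscreteRep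
open scoped ContRepresentation

namespace Literature.NumberTheory.GaloisRepresentations

/-! ## §1. Restriction to `K_v` on explicit `2`-cocycles -/

namespace galoisCohomology

/-- **Restriction on `2`-cocycles**: `res [c] = [c ∘ (Γ_L → Γ_K)²]` (Mathlib `ContinuousCohomology.map` on explicit
`2`-cocycles, tree `map_twoCocycleClass`). [cite: SerreGaloisCohomology1997, I §2.4] -/
theorem res_twoCocycleClass {K : Type} [Field K] {M : Type} [AddCommGroup M] [TopologicalSpace M] [DiscreteTopology M]
    (ρ : DiscreteGaloisModule K M) [CompactSpace (absoluteGaloisGroup K)] (L : Type) [Field L] [Algebra K L]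
    [CompactSpace (absoluteGaloisGroup L)] (c : contTwoCocycles ρ.toTopRep) :
    galoisCohomology.res ρ L 2 (twoCocycleClass ρ.toTopRep c) =
      twoCocycleClass (DiscreteGaloisModule.toTopRep (ρ.restrictField L))
        (contTwoCocycles.pullback (absGaloisRestrict K L)
          (TopRep.ofHom ⟨ContinuousLinearMap.id ℤ M, fun _ => rfl⟩ :
            TopRep.res (absGaloisRestrict K L : absoluteGaloisGroup L →* absoluteGaloisGroup K)
              ρ.toTopRep ⟶ DiscreteGaloisModule.toTopRep (ρ.restrictField L)) c) :=
  map_twoCocycleClass _ _ _ c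

end galoisCohomology

namespace GalLayerData

/-- **The layer cohomology isomorphism on `2`-cocycles**: `iso_E [b] = [b₀]` with
`b₀ (g, h) = layerEquiv (b (quotEquiv⁻¹ g, quotEquiv⁻¹ h))` (Mathlib `groupCohomology.mapIso` / `H2π_comp_map`).
[cite: SerreGaloisCohomology1997, I §2.2 Proposition 8] -/
theorem exists_layerCohomologyIso_hom_H2π_eq {F : Type} [Field F] [NumberField F] (D : GalLayerData F)
    (E : IdeleClassBar.GalLayer F) (b : cocycles₂ (D.layerRep E)) :
    ∃ b₀ : cocycles₂ (D.obj E), (D.layerCohomologyIso E 2).hom (H2π _ b) = H2π _ b₀ ∧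
      ∀ g h : (E.1 ≃ₐ[F] E.1), b₀ (g, h) = D.layerEquiv E (b (E.quotEquiv.symm g, E.quotEquiv.symm h)) :=
  ⟨mapCocycles₂ E.quotEquiv.symm.toMonoidHom _ b, H2π_comp_map_apply _ _ b, fun _ _ => rfl⟩

end GalLayerData

namespace HomDual

open IdeleClassBar DGMBridge FreePresentation LayerDelta IdeleReadout IdeleCohomology DiscreteGaloisModule
open Literature.AnabelianGeometry.AbsoluteAnabelian.Prop121vii (brauerInvariantEquiv)
open Literature.NumberTheory.Automorphic

-- `LocallyCompactSpace Γ_{K_v}` (needed by `twoCocycleClass`) comes from the tree's instance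
-- `absoluteGaloisGroup.instCompactSpace [CharZero ·]`; `CharZero (v.adicCompletion K)` is supplied by `haveI` below.

variable {K : Type} [Field K] [NumberField K]
variable {M : Type} [AddCommGroup M] [TopologicalSpace M] [DiscreteTopology M] [Finite M] (ρ : DiscreteGaloisModule K M)
variable (E : GalLayer K) (v : HeightOneSpectrum (𝓞 K)) (π : IdeleProjection K (Sum.inr v))

/-! ## §2. Pulls of cohomologous cocycles -/

omit [NumberField K] in
/-- Pull-backs along a compatible pair of two COHOMOLOGOUS finite-level `2`-cocycles have the same continuous class.
[cite: SerreGaloisCohomology1997, I §2.4] -/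
theorem twoCocycleClass_pull_eq_of_H2π_eq {G : Type} [Group G] {A : Rep.{0} ℤ G} {Γ : Type} [Group Γ]
    [TopologicalSpace Γ] [IsTopologicalGroup Γ] [LocallyCompactSpace Γ] {X : TopRep.{0} ℤ Γ}
    (P : CompatiblePair A X) (b b' : cocycles₂ A) (h : H2π A b = H2π A b') :
    twoCocycleClass X (P.pull b) = twoCocycleClass X (P.pull b') := by
  have hzero : twoCocycleClass X (P.pull (b - b')) = 0 :=
    P.twoCocycleClass_pull_eq_zero_of_mem_coboundaries _ ((H2π_eq_iff b b').1 h)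
  rwa [CompatiblePair.pull_sub, twoCocycleClass_sub, sub_eq_zero] at hzero

omit [NumberField K] in
/-- Evaluation of a mapped `2`-cochain: `C²(f, φ) x (g, h) = φ (x (f g, f h))` (by `simp`; the `rfl` proof is too expensive).
[cite: SerreGaloisCohomology1997, I §2.4] -/
theorem cochainsMap₂_apply {G H : Type} [Group G] [Group H] {A : Rep.{0} ℤ H} {B : Rep.{0} ℤ G} (f : G →* H)
    (φ : Rep.res f A ⟶ B) (x : H × H → A.V) (g h : G) :
    cochainsMap₂ f φ x (g, h) = φ.hom (x (f g, f h)) := by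
  simp [cochainsMap₂]

/-! ## §3. The readout class of an inflated layer class is the pull-back of the idèle layer class

The computation is split over several declarations: each elaboration of the readout morphism (stated over
`Place.Completion (inr v)`) against `v.adicCompletion K` is expensive, and one declaration per step keeps every step within
the default heartbeat budget. -/

/-- The group component of door-c5's readout pair at a layer, through `quotEquiv`: `quotEquiv⁻¹ (s|_E) = [res_v s]`.
[cite: CasselsFrohlichANT1967, Ch. VII §1.1] -/
theorem quotEquiv_symm_readoutPair_f (u : absoluteGaloisGroup (v.adicCompletion K)) :
    (haveI := E.numberField; haveI := E.isGalois; E.quotEquiv.symm ((readoutPair v (layerEmb E)).f u)) =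
      QuotientGroup.mk (absGaloisRestrict K (v.adicCompletion K) u) := by
  haveI := E.numberField
  haveI := E.isGalois
  rw [readoutPair_f, galRestrict_layerEmb, GalLayer.quotEquiv_symm_restrictHom]

/-- The module component of door-c5's readout pair on the layer `J_E ≅ J̄^{U_E}`, for a layer-compatible `π_v`:
`π_v^E (layerEquiv z) = π_v z`. [cite: MilneADT2006, I Lemma 4.13 (proof)] -/
theorem readoutPair_φ_layerEquiv
    (hπ : ∀ x : (ideleData K).V E, π.toAddMonoidHom ((ideleData K).toSystem.of E x) =
      (haveI := E.numberField; haveI := E.isGalois; idelePlaceReadout v (layerEmb E) x))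
    (z : (ideleData K).layerRep E) :
    (haveI := E.numberField; haveI := E.isGalois; (readoutPair v (layerEmb E)).φ ((ideleData K).layerEquiv E z)) =
      π.toAddMonoidHom (z.1 : (ideleData K).toSystem.limit) := by
  haveI := E.numberField
  haveI := E.isGalois
  rw [readoutPair_φ, ← hπ, GalLayerData.of_layerEquiv]

/-- Steps 1–2 (the K-side): `(π_v ∘ f)_* res_v (inf_E (toAbsLayer [b]))` is the class of a continuous `2`-cocycle with the
values `(s, t) ↦ π_v (f (b([res s], [res t])))`. [cite: SerreGaloisCohomology1997, I §2.2 Prop. 8, §2.4][cite: MilneADT2006, I Lemma 4.13 (proof)] -/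
theorem exists_readout_infTwo_toAbsLayer_eq (f : (presentationComplex ρ).X₁ ⟶ ideleBarD K)
    (b : cocycles₂ ((invariantsQuotFunctor ℤ (E.openNormalSubgroup : Subgroup (absoluteGaloisGroup K))).obj
      (presentationComplex ρ).X₁)) :
    ∃ c : contTwoCocycles (units (v.adicCompletion K)).toTopRep,
      (haveI := moduleFinite_presModule₁ ρ; haveI := normal_layer E; haveI := finiteDimensional_layer E;
        haveI : CharZero (v.adicCompletion K) := charZero_of_algebra (K := K) (v.adicCompletion K);
        cohomologyMap (toTopRepHom ((presModule₁ ρ).restrictField (v.adicCompletion K)) (units (v.adicCompletion K))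
            (equivariantMap ((presModule₁ ρ).restrictField (v.adicCompletion K)) (units (v.adicCompletion K))
              (readoutInvariant π (presentationComplex ρ).X₁ f))) 2
          (galoisCohomology.res (presModule₁ ρ) (v.adicCompletion K) 2
            (infTwo K E.1 (presModule₁ ρ) (toAbsLayer E (presentationComplex ρ).X₁ 2 (H2π _ b)))) =
        twoCocycleClass (units (v.adicCompletion K)).toTopRep c) ∧
      ∀ s t : absoluteGaloisGroup (v.adicCompletion K), c.1 (s, t) =
        π.toAddMonoidHom (f.hom.hom
          (b (QuotientGroup.mk (absGaloisRestrict K (v.adicCompletion K) s),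
              QuotientGroup.mk (absGaloisRestrict K (v.adicCompletion K) t))).1) := by
  haveI := moduleFinite_presModule₁ ρ
  haveI := normal_layer E
  haveI := finiteDimensional_layer E
  haveI : CharZero (v.adicCompletion K) := charZero_of_algebra (K := K) (v.adicCompletion K)
  rw [toAbsLayer_H2π, infTwo_H2π, galoisCohomology.res_twoCocycleClass, cohomologyMap_twoCocycleClass]
  refine ⟨_, rfl, fun s t => ?_⟩
  rw [pullback₂_id_resIdHom_apply, contTwoCocycles.pullback_apply, inflateTwoCocycle_apply, coe_mapCocycles₂,
    cochainsMap₂_apply]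
  rfl

/-- Step 3 (the E-side): for a `2`-cocycle `b'` of `Gal(E/K)` in `J_E` with the values
`b'(g, h) = layerEquiv (f^{U_E} (b (quotEquiv⁻¹ g, quotEquiv⁻¹ h)))`, the pull-back along door-c5's readout pair has the values
`(s, t) ↦ π_v (f (b([res s], [res t])))` too — GIVEN that `π_v` reads the layer `J_E ⊆ J̄` through
`idelePlaceReadout v (layerEmb E)` (hypothesis `hπ`). [cite: MilneADT2006, I Lemma 4.13 (proof)][cite: CasselsFrohlichANT1967, Ch. VII §1.1] -/
theorem pull_readoutPair_apply
    (hπ : ∀ x : (ideleData K).V E, π.toAddMonoidHom ((ideleData K).toSystem.of E x) =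
      (haveI := E.numberField; haveI := E.isGalois; idelePlaceReadout v (layerEmb E) x))
    (f : (presentationComplex ρ).X₁ ⟶ ideleBarD K)
    (b : cocycles₂ ((invariantsQuotFunctor ℤ (E.openNormalSubgroup : Subgroup (absoluteGaloisGroup K))).obj
      (presentationComplex ρ).X₁))
    (b' : haveI := E.numberField; cocycles₂ (IdeleClassGroup.ideleRep K E.1))
    (hb' : ∀ g h : (E.1 ≃ₐ[K] E.1), b' (g, h) =
      (ideleData K).layerEquiv E
        (((invariantsQuotFunctor ℤ (E.openNormalSubgroup : Subgroup (absoluteGaloisGroup K))).map f).hom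
          (b (E.quotEquiv.symm g, E.quotEquiv.symm h))))
    (s t : absoluteGaloisGroup (v.adicCompletion K)) :
    (haveI := E.numberField; haveI := E.isGalois; ((readoutPair v (layerEmb E)).pull b').1 (s, t)) =
      π.toAddMonoidHom (f.hom.hom
        (b (QuotientGroup.mk (absGaloisRestrict K (v.adicCompletion K) s),
            QuotientGroup.mk (absGaloisRestrict K (v.adicCompletion K) t))).1) := by
  haveI := E.numberField
  haveI := E.isGalois
  rw [CompatiblePair.pull_apply, hb', quotEquiv_symm_readoutPair_f, quotEquiv_symm_readoutPair_f,
    readoutPair_φ_layerEquiv E v π hπ]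
  rfl

/-- **For every `2`-cocycle `b` of `Γ_K ⧸ U_E` in `N₁^{U_E}` and every `2`-cocycle `b'` of `Gal(E/K)` in `J_E` with the values
`b'(g, h) = layerEquiv (f^{U_E} (b (quotEquiv⁻¹ g, quotEquiv⁻¹ h)))` (the canonical representative of
`iso^J_E ((f^{U_E})_* [b])`): `(π_v ∘ f)_* res_v (inf_E (toAbsLayer [b])) = [pull_{readoutPair v (layerEmb E)} b']` in
`H²(K_v, K̄_vˣ)`** — both are the class of the continuous `2`-cocycle `(s, t) ↦ π_v (f (b([s|], [t|])))` of `Γ_{K_v}`,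
GIVEN that `π_v` reads the layer `J_E ⊆ J̄` through `idelePlaceReadout v (layerEmb E)` (hypothesis `hπ`).
[cite: MilneADT2006, I Lemma 4.13 (proof)][cite: SerreGaloisCohomology1997, I §2.2 Prop. 8, §2.4] -/
theorem twoCocycleClass_readout_infTwo_eq_pull
    (hπ : ∀ x : (ideleData K).V E, π.toAddMonoidHom ((ideleData K).toSystem.of E x) =
      (haveI := E.numberField; haveI := E.isGalois; idelePlaceReadout v (layerEmb E) x))
    (f : (presentationComplex ρ).X₁ ⟶ ideleBarD K)
    (b : cocycles₂ ((invariantsQuotFunctor ℤ (E.openNormalSubgroup : Subgroup (absoluteGaloisGroup K))).obj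
      (presentationComplex ρ).X₁))
    (b' : haveI := E.numberField; cocycles₂ (IdeleClassGroup.ideleRep K E.1))
    (hb' : ∀ g h : (E.1 ≃ₐ[K] E.1), b' (g, h) =
      (ideleData K).layerEquiv E
        (((invariantsQuotFunctor ℤ (E.openNormalSubgroup : Subgroup (absoluteGaloisGroup K))).map f).hom
          (b (E.quotEquiv.symm g, E.quotEquiv.symm h)))) :
    (haveI := moduleFinite_presModule₁ ρ; haveI := normal_layer E; haveI := finiteDimensional_layer E;
      cohomologyMap (toTopRepHom ((presModule₁ ρ).restrictField (v.adicCompletion K)) (units (v.adicCompletion K))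
          (equivariantMap ((presModule₁ ρ).restrictField (v.adicCompletion K)) (units (v.adicCompletion K))
            (readoutInvariant π (presentationComplex ρ).X₁ f))) 2
        (galoisCohomology.res (presModule₁ ρ) (v.adicCompletion K) 2
          (infTwo K E.1 (presModule₁ ρ) (toAbsLayer E (presentationComplex ρ).X₁ 2 (H2π _ b))))) =
      (haveI := E.numberField; haveI := E.isGalois;
        haveI : CharZero (v.adicCompletion K) := charZero_of_algebra (K := K) (v.adicCompletion K);
        twoCocycleClass (units (v.adicCompletion K)).toTopRep ((readoutPair v (layerEmb E)).pull b')) := by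
  haveI : CharZero (v.adicCompletion K) := charZero_of_algebra (K := K) (v.adicCompletion K)
  obtain ⟨c, hc, hcv⟩ := exists_readout_infTwo_toAbsLayer_eq ρ E v π f b
  rw [hc]
  refine congrArg (twoCocycleClass (units (v.adicCompletion K)).toTopRep) (Subtype.ext (ContinuousMap.ext fun st => ?_))
  obtain ⟨s, t⟩ := st
  rw [hcv, pull_readoutPair_apply ρ E v π hπ f b b' hb']

/-- **The finite-place dictionary on classes: `inv_{K_v}((π_v ∘ f)_* res_v (inf_E (toAbsLayer w))) =
localInv E v (iso^J_E ((f^{U_E})_* w))`** for every `w ∈ H²(Γ_K ⧸ U_E, N₁^{U_E})` (door-c5's `localInv_eq_readout` on the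
canonical representative). [cite: CasselsFrohlichANT1967, Ch. VII §7.3 Cor. 7.4 (b), §11.2 (bis)][cite: MilneADT2006, I Lemma 4.13 (proof)] -/
theorem brauerInvariantEquiv_readout_infTwo_eq_localInv
    (hπ : ∀ x : (ideleData K).V E, π.toAddMonoidHom ((ideleData K).toSystem.of E x) =
      (haveI := E.numberField; haveI := E.isGalois; idelePlaceReadout v (layerEmb E) x))
    (f : (presentationComplex ρ).X₁ ⟶ ideleBarD K)
    (w : groupCohomology ((invariantsQuotFunctor ℤ (E.openNormalSubgroup : Subgroup (absoluteGaloisGroup K))).obj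
      (presentationComplex ρ).X₁) 2) :
    (haveI := moduleFinite_presModule₁ ρ; haveI := normal_layer E; haveI := finiteDimensional_layer E;
      haveI : CharZero (v.adicCompletion K) := charZero_of_algebra (K := K) (v.adicCompletion K);
      brauerInvariantEquiv (v.adicCompletion K)
        (cohomologyMap (toTopRepHom ((presModule₁ ρ).restrictField (v.adicCompletion K)) (units (v.adicCompletion K))
            (equivariantMap ((presModule₁ ρ).restrictField (v.adicCompletion K)) (units (v.adicCompletion K))
              (readoutInvariant π (presentationComplex ρ).X₁ f))) 2
          (galoisCohomology.res (presModule₁ ρ) (v.adicCompletion K) 2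
            (infTwo K E.1 (presModule₁ ρ) (toAbsLayer E (presentationComplex ρ).X₁ 2 w))))) =
      (haveI := E.numberField; haveI := E.isGalois;
        localInv E.1 v
          (((ideleData K).layerCohomologyIso E 2).hom
            (groupCohomology.map (MonoidHom.id _)
              ((invariantsQuotFunctor ℤ (E.openNormalSubgroup : Subgroup (absoluteGaloisGroup K))).map f) 2 w))) := by
  haveI := moduleFinite_presModule₁ ρ
  haveI := normal_layer E
  haveI := finiteDimensional_layer E
  haveI := E.numberField
  haveI := E.isGalois
  haveI : CharZero (v.adicCompletion K) := charZero_of_algebra (K := K) (v.adicCompletion K)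
  induction w using H2_induction_on with
  | h b =>
    -- everything with a NATIVE `b' ∈ Z²(Gal(E/K), J_E)`; the layer representative is substituted at the end
    have key : ∀ b' : cocycles₂ (IdeleClassGroup.ideleRep K E.1),
        (∀ g h : (E.1 ≃ₐ[K] E.1), b' (g, h) =
          (ideleData K).layerEquiv E
            (((invariantsQuotFunctor ℤ (E.openNormalSubgroup : Subgroup (absoluteGaloisGroup K))).map f).hom
              (b (E.quotEquiv.symm g, E.quotEquiv.symm h)))) →
        ((ideleData K).layerCohomologyIso E 2).hom
            (groupCohomology.map (MonoidHom.id _)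
              ((invariantsQuotFunctor ℤ (E.openNormalSubgroup : Subgroup (absoluteGaloisGroup K))).map f) 2 (H2π _ b)) =
          H2π (IdeleClassGroup.ideleRep K E.1) b' →
        brauerInvariantEquiv (v.adicCompletion K)
          (cohomologyMap (toTopRepHom ((presModule₁ ρ).restrictField (v.adicCompletion K)) (units (v.adicCompletion K))
              (equivariantMap ((presModule₁ ρ).restrictField (v.adicCompletion K)) (units (v.adicCompletion K))
                (readoutInvariant π (presentationComplex ρ).X₁ f))) 2
            (galoisCohomology.res (presModule₁ ρ) (v.adicCompletion K) 2
              (infTwo K E.1 (presModule₁ ρ) (toAbsLayer E (presentationComplex ρ).X₁ 2 (H2π _ b))))) =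
          localInv E.1 v
            (((ideleData K).layerCohomologyIso E 2).hom
              (groupCohomology.map (MonoidHom.id _)
                ((invariantsQuotFunctor ℤ (E.openNormalSubgroup : Subgroup (absoluteGaloisGroup K))).map f) 2
                (H2π _ b))) := fun b' hb'v hβ =>
      ((congrArg (brauerInvariantEquiv (v.adicCompletion K))
          (twoCocycleClass_readout_infTwo_eq_pull ρ E v π hπ f b b' hb'v)).trans
        (localInv_eq_readout v (layerEmb E) b').symm).trans (congrArg (localInv E.1 v) hβ).symm
    -- the layer representative (implicit `A`, `B` of `H2π_comp_map_apply` given explicitly: unifying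
    -- `Rep.res (MonoidHom.id _) ?A` against a functor image is expensive)
    obtain ⟨b₀, hb₀, hb₀v⟩ := (ideleData K).exists_layerCohomologyIso_hom_H2π_eq E
      (mapCocycles₂ (MonoidHom.id _)
        ((invariantsQuotFunctor ℤ (E.openNormalSubgroup : Subgroup (absoluteGaloisGroup K))).map f) b)
    have h0 := H2π_comp_map_apply
      (A := (invariantsQuotFunctor ℤ (E.openNormalSubgroup : Subgroup (absoluteGaloisGroup K))).obj
        (presentationComplex ρ).X₁)
      (B := (invariantsQuotFunctor ℤ (E.openNormalSubgroup : Subgroup (absoluteGaloisGroup K))).obj (ideleBarD K))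
      (MonoidHom.id _) ((invariantsQuotFunctor ℤ (E.openNormalSubgroup : Subgroup (absoluteGaloisGroup K))).map f) b
    refine key b₀ (fun g h => (hb₀v g h).trans ?_)
      ((congrArg (fun z => ((ideleData K).layerCohomologyIso E 2).hom z) h0).trans hb₀)
    rw [coe_mapCocycles₂, cochainsMap₂_apply]
    rfl

/-- **The K-side finite local term of the reciprocity sum IS the idèle local invariant of door-c4's class `β`** (without
signs): for a layer `E ⊇ K(M)`, a layer class `c ∈ H¹(Γ_K ⧸ U_E, M^{U_E})`, `f : N₁ → J̄` and the native global class
`x := infOneLayer K E ρ (toAbsLayerOf E ρ 1 c) ∈ H¹(K, M)`: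
`inv_{K_v}((π_v ∘ f)_* res_v (δ₁^K x)) = localInv E v (iso^J_E ((f^{U_E})_* (δ_{S^{U_E}} c)))` — (N2) in door-c4's currency
(`LayerDelta.δ₁_infOneLayer_toAbsLayerOf`) followed by `brauerInvariantEquiv_readout_infTwo_eq_localInv`.
[cite: MilneADT2006, I Thm. 4.10 (proof, p. 58), Lemma 4.13][cite: CasselsFrohlichANT1967, Ch. VII §11.2 (bis)] -/
theorem brauerInvariantEquiv_readout_δ₁_infOneLayer_eq_localInv
    (hπ : ∀ x : (ideleData K).V E, π.toAddMonoidHom ((ideleData K).toSystem.of E x) =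
      (haveI := E.numberField; haveI := E.isGalois; idelePlaceReadout v (layerEmb E) x))
    (f : (presentationComplex ρ).X₁ ⟶ ideleBarD K) (h : presentationLayer ρ ≤ E)
    (c : groupCohomology ((invariantsQuotFunctor ℤ (E.openNormalSubgroup : Subgroup (absoluteGaloisGroup K))).obj
      (presentationComplex ρ).X₃) 1) :
    (haveI := moduleFinite_presModule₁ ρ; haveI := normal_layer E; haveI := finiteDimensional_layer E;
      haveI : CharZero (v.adicCompletion K) := charZero_of_algebra (K := K) (v.adicCompletion K);
      brauerInvariantEquiv (v.adicCompletion K)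
        (cohomologyMap (toTopRepHom ((presModule₁ ρ).restrictField (v.adicCompletion K)) (units (v.adicCompletion K))
            (equivariantMap ((presModule₁ ρ).restrictField (v.adicCompletion K)) (units (v.adicCompletion K))
              (readoutInvariant π (presentationComplex ρ).X₁ f))) 2
          (galoisCohomology.res (presModule₁ ρ) (v.adicCompletion K) 2
            ((pres_isSES ρ).δ₁ (infOneLayer K E.1 ρ (toAbsLayerOf E ρ 1 c)))))) =
      (haveI := E.numberField; haveI := E.isGalois;
        localInv E.1 v
          (((ideleData K).layerCohomologyIso E 2).hom
            (groupCohomology.map (MonoidHom.id _)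
              ((invariantsQuotFunctor ℤ (E.openNormalSubgroup : Subgroup (absoluteGaloisGroup K))).map f) 2
              (groupCohomology.δ (presentationComplex_map_invariantsQuotFunctor_shortExact ρ h) 1 2 rfl c)))) := by
  haveI := normal_layer E
  haveI := finiteDimensional_layer E
  rw [δ₁_infOneLayer_toAbsLayerOf ρ h c]
  exact brauerInvariantEquiv_readout_infTwo_eq_localInv ρ E v π hπ f _

end HomDual

end Literature.NumberTheory.GaloisRepresentations

end
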